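import Literature.NumberTheory.Automorphic.Liu2021.AppendixC.SecC3Connection
import Literature.NumberTheory.Automorphic.Liu2021.AppendixC.DefC1toC3Aux
import Literature.FieldTheory.AlgClosed.AutFixedSubfield
import Literature.FieldTheory.AlgClosed.AutComplexFixingSubgroupInf
import Literature.NumberTheory.Automorphic.Liu2021.AppendixC.HermSpaceSylvester
import Mathlib.FieldTheory.Normal.Closure
import HarnessLib

/-!
# Liu 2021, Appendix C §C.3 — discharges of Remark C.15 (`RemC15AsPrinted_holds`) and, ED. 2, Lemma C.14 (`LemC14AsPrinted_holds`)

Proof file (theorems only: no definition, no named fact, no instance, no notation, no `sorry`), sibling of the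
statement-only carpet ★ `Literature/NumberTheory/Automorphic/Liu2021/AppendixC/SecC3Connection.lean`
[Liu2021, App. C §C.3, print pp. 112–117].  Of that carpet's two CLOSED named facts (`LemC14AsPrinted`,
`RemC15AsPrinted`; its other four `Prop` heads are predicates over the posited `SecC3Data` / `DefC19Data`) this file
discharges ONE, statement byte-unchanged (it lives in the carpet):

* `RemC15AsPrinted_holds` — [Liu2021, Rem. C.15, first sentence (p. 113 L45–52)]: «the hermitian space `V` … will have
  signature `(n − 1, 1)` at one place `τ ∈ Φ_F` and `(n, 0)` elsewhere … Then for whatever `Φ`, we have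
  `E♭_{V,Φ} = τ'(E)`, where `τ' ∈ Φ_E` is either place above `τ`.»

Proof (the remark is printed without proof; this is the evident argument from Def. C.1):
1. under the signature hypothesis (★ `HermSpace.IsSignatureN1At`), the element `sig♭_{V,Φ} = Σ_τ q_τ τ⁻ ∈ ℕ[Φ_E]` of
   display (C.1) is the single generator `[τ⁻]`, `τ⁻ ∈ Φ` the element above `τ` (★ `HermSpace.sigFlatElt_apply`) —
   `sigFlatElt_eq_single_of_isSignatureN1At`;
2. the stabilizer of `[τ⁻]` in `Gal(ℂ/ℚ) = (ℂ ≃ₐ[ℚ] ℂ)` is `{σ | σ ∘ τ⁻ = τ⁻} = Aut(ℂ/τ⁻(E))`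
   (`Finsupp.mapDomain_single`) — `mem_stabilizer_single_iff`;
3. the fixed field of `Aut(ℂ/τ⁻(E))` is `τ⁻(E)`: «the fixed field of `Aut(ℂ/F)` is `F`» for the countable subfield
   `F = τ⁻(E) ⊆ ℂ` is the tree's ★ `Literature.FieldTheory.AlgClosed.Complex.mem_subfield_of_forall_ringEquiv`
   (`AutFixedSubfield.lean`; Lang, *Algebra*, Ch. VIII §1), an automorphism `σ : ℂ ≃+* ℂ` being upgraded to
   `ℂ ≃ₐ[ℚ] ℂ` by `AlgEquiv.ofRingEquiv` exactly as in ★ `AutComplexGeneratedBySubfields.lean` —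
   `fixedField_stabilizer_single_eq`;
4. «either place above `τ`»: a second embedding above `τ` is `τ⁻` or its complex conjugate
   (★ `eq_or_eq_conjugate_of_restr_eq`), and `\bar{τ⁻}(E) = τ⁻(E)` because `E/F` is CM
   (★ `complexEmbedding_conj`: `φ ∘ c = \bar{·} ∘ φ`) — `fieldRange_conjugate`.
The printed hypothesis `n ≥ 2` is carried by the statement but not used by the proof.

**ED. 2** (squad TL, RULINGS g2-6 / g2-7) discharges the carpet's OTHER closed fact, `LemC14AsPrinted`
(`E_{V,Φ} ⊆ E♯_{V,Φ}`), following the printed proof (l. 4793–4795): its silent input `p_τ + q_τ = n` — Sylvester's law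
of inertia for the tree's `HermSpace.posIndex` / `negIndex` — is now ★ `HermSpace.posIndex_add_negIndex` (sibling
`HermSpaceSylvester.lean`); the Galois-closedness half uses ★ `AutComplexClosedSubgroups` / ★ `AutComplexFiniteIndex`
with the number field `Ẽ = normalClosure ℚ E ℂ`.  See the section docstring «ED. 2» below (Steps 5–7 +
`LemC14AsPrinted_holds`); ED. 1's five theorems are byte-unchanged.

## References
* [Liu2021] Y. Liu, *Fourier–Jacobi cycles and arithmetic relative trace formula*, Camb. J. Math. 9 (2021) 1–147,
  App. C, display (C.1) and Def. C.1 (p. 107), Rem. C.2 (p. 108), Rem. C.15 (p. 113 L45–52).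
* [Lang2002] S. Lang, *Algebra*, rev. 3rd ed., GTM 211, Springer 2002, Ch. VIII §1 (automorphisms of `ℂ` over a
  subfield), as used by ★ `AutFixedSubfield.lean`.
-/

noncomputable section

open NumberField NumberField.ComplexEmbedding Cardinal
open Literature.AlgebraicGeometry.Motives (CMType)
open Literature.FieldTheory.AlgClosed

namespace Literature.NumberTheory.Automorphic.Liu2021.AppendixC.SecC3Connection

variable {F E : Type} [Field F] [NumberField F] [IsTotallyReal F] [Field E] [NumberField E] [Algebra F E]
  [IsTotallyComplex E] [Algebra.IsQuadraticExtension F E]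

/-- **Step 1.** Under the hypothesis of Rem. C.2 / Rem. C.15 («signature `(n−1,1)` at `τ` and `(n,0)` at other
places», ★ `HermSpace.IsSignatureN1At`), the element `sig♭_{V,Φ} = Σ_{τ₀} q_{τ₀} τ₀⁻ ∈ ℕ[Φ_E]` of display (C.1) is the
single generator `[τ⁻]` with coefficient `1`, `τ⁻ = CMType.above Φ τ` the element of `Φ` above `τ`
(by ★ `HermSpace.sigFlatElt_apply`: the coefficient at `φ ∈ Φ` is `q_{π φ}`, and `0` off `Φ`).
[cite: Liu2021, Rem. C.15 (p. 113) with Def. C.1 / (C.1) (p. 107)] -/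
theorem sigFlatElt_eq_single_of_isSignatureN1At (V : HermSpace F E) {τ : F →+* ℝ}
    (hV : V.IsSignatureN1At τ) (Φ : CMType E) :
    V.sigFlatElt Φ = Finsupp.single (CMType.above F E Φ τ) 1 := by
  classical
  ext φ
  rw [V.sigFlatElt_apply Φ φ, Finsupp.single_apply]
  by_cases hφ : φ ∈ Φ.1
  · rw [if_pos hφ]
    by_cases hτ : restr F E φ = τ
    · have h1 : φ = CMType.above F E Φ τ := CMType.eq_above F E hφ hτ
      rw [if_pos h1.symm, hτ, hV.1]
    · have h1 : CMType.above F E Φ τ ≠ φ := fun h => hτ (h ▸ (CMType.above_spec F E Φ τ).2)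
      rw [if_neg h1, hV.2 _ hτ]
  · rw [if_neg hφ]
    have h1 : CMType.above F E Φ τ ≠ φ := fun h => hφ (h ▸ (CMType.above_spec F E Φ τ).1)
    rw [if_neg h1]

omit [NumberField F] [IsTotallyReal F] [NumberField E] [IsTotallyComplex E] [Algebra.IsQuadraticExtension F E] in
/-- **Step 2.** The stabilizer in `Gal(ℂ/ℚ) = (ℂ ≃ₐ[ℚ] ℂ)` (★ `stabilizer`, Def. C.1) of a single generator
`[φ₀] ∈ ℕ[Φ_E]` is `Aut(ℂ/φ₀(E))`: `σ · [φ₀] = [σ ∘ φ₀]` (`Finsupp.mapDomain_single`) equals `[φ₀]` iff `σ ∘ φ₀ = φ₀`,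
i.e. iff `σ` fixes `φ₀(E)` pointwise. [cite: Liu2021, Def. C.1 (p. 107), «the stabilizer in Gal(ℂ/ℚ)»] -/
theorem mem_stabilizer_single_iff (φ₀ : E →+* ℂ) (σ : ℂ ≃ₐ[ℚ] ℂ) :
    σ ∈ stabilizer E (Finsupp.single φ₀ 1) ↔ ∀ x : E, σ (φ₀ x) = φ₀ x := by
  rw [mem_stabilizer_iff, galActElt, Finsupp.mapDomain_single]
  constructor
  · intro h x
    have h' : galAct E σ φ₀ = φ₀ := Finsupp.single_left_injective one_ne_zero h
    exact congrArg (fun f : E →+* ℂ => f x) h'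
  · intro h
    have h' : galAct E σ φ₀ = φ₀ := RingHom.ext h
    rw [h']

omit [NumberField F] [IsTotallyReal F] [IsTotallyComplex E] [Algebra.IsQuadraticExtension F E] in
/-- **Step 3.** The fixed field (Mathlib `IntermediateField.fixedField`, as in Def. C.1) of the stabilizer of `[φ₀]`,
i.e. of `Aut(ℂ/φ₀(E))`, is `φ₀(E)`, for a number field `E`: `⊇` is formal; `⊆` is «the fixed field of `Aut(ℂ/F)` is `F`»
for the countable subfield `F = φ₀(E) ⊆ ℂ` — the tree's ★ `Complex.mem_subfield_of_forall_ringEquiv`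
(`AutFixedSubfield.lean`), after upgrading `σ : ℂ ≃+* ℂ` to `ℂ ≃ₐ[ℚ] ℂ` (`AlgEquiv.ofRingEquiv`, `map_ratCast`);
`#φ₀(E) = #E ≤ ℵ₀` by `Algebra.IsAlgebraic.cardinalMk_le_max`.
[cite: Lang2002, Ch. VIII §1 (automorphisms of ℂ fixing a subfield; via ★ AutFixedSubfield)] -/
theorem fixedField_stabilizer_single_eq (φ₀ : E →+* ℂ) :
    (IntermediateField.fixedField (stabilizer E (Finsupp.single φ₀ 1))).toSubfield = φ₀.fieldRange := by
  ext z
  rw [IntermediateField.mem_toSubfield, IntermediateField.mem_fixedField_iff]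
  constructor
  · intro hz
    -- `φ₀(E) ≅ E` is a number field inside `ℂ`, hence countable
    have hF : #φ₀.fieldRange ≤ ℵ₀ := by
      have h1 : #φ₀.fieldRange = #E := by
        change #(↥(φ₀.fieldRange : Set ℂ)) = #E
        rw [RingHom.coe_fieldRange, Cardinal.mk_range_eq _ φ₀.injective]
      rw [h1]
      exact (Algebra.IsAlgebraic.cardinalMk_le_max ℚ E).trans (by simp)
    refine Complex.mem_subfield_of_forall_ringEquiv φ₀.fieldRange hF fun σ hσ => ?_
    -- upgrade `σ` to a `ℚ`-algebra automorphism (automatic in characteristic `0`) and use `hz`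
    let σ' : ℂ ≃ₐ[ℚ] ℂ := AlgEquiv.ofRingEquiv (f := σ) fun q => by simp
    have hmem : σ' ∈ stabilizer E (Finsupp.single φ₀ 1) := by
      rw [mem_stabilizer_single_iff]
      intro x
      exact hσ (φ₀ x) ⟨x, rfl⟩
    exact hz σ' hmem
  · rintro ⟨x, rfl⟩ σ hσ
    exact (mem_stabilizer_single_iff φ₀ σ).1 hσ x

/-- **Step 4.** For the CM extension `E/F` the image `φ(E) ⊆ ℂ` of a complex embedding `φ ∈ Φ_E` is stable under
complex conjugation — `\bar{φ x} = φ (c x)` (★ `complexEmbedding_conj`, `c` = ★ `conj F E` the nontrivial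
involution of `E/F`, App. C l. 4550) — so the conjugate embedding `\bar φ` has the same image: this is why Rem. C.15
may say «either place above `τ`». [cite: Liu2021, Rem. C.15 (p. 113), «τ' ∈ Φ_E is either place above τ»] -/
theorem fieldRange_conjugate (F : Type) {E : Type} [Field F] [IsTotallyReal F] [Field E] [NumberField E]
    [Algebra F E] [IsTotallyComplex E] [Algebra.IsQuadraticExtension F E] (φ : E →+* ℂ) :
    (conjugate φ).fieldRange = φ.fieldRange := by
  ext z
  simp only [RingHom.mem_fieldRange]
  constructor
  · rintro ⟨x, rfl⟩
    exact ⟨conj F E x, by rw [complexEmbedding_conj, conjugate_coe_eq]⟩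
  · rintro ⟨x, rfl⟩
    refine ⟨conj F E x, ?_⟩
    rw [conjugate_coe_eq, complexEmbedding_conj, starRingEnd_self_apply]

/-- **[Liu2021, Remark C.15], first sentence, HOLDS** — discharge of the CLOSED named fact ★ `RemC15AsPrinted` of the
carpet ★ `SecC3Connection.lean` (statement byte-unchanged there): for a hermitian space `V` over the CM extension
`E/F` of signature `(n−1,1)` at `τ ∈ Φ_F` and `(n,0)` elsewhere, every CM type `Φ` and every `τ' ∈ Φ_E` above `τ`,
the reduced reflex field `E♭_{V,Φ}` (Def. C.1: the fixed field of the stabilizer of `sig♭_{V,Φ}` in `Gal(ℂ/ℚ)`) is the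
subfield `τ'(E) ⊆ ℂ`.  Assembly of Steps 1–4: `E♭_{V,Φ} = Fix(Stab [τ⁻]) = Fix(Aut(ℂ/τ⁻(E))) = τ⁻(E) = τ'(E)`.
The printed `n ≥ 2` is not used. [cite: Liu2021, Rem. C.15 (p. 113 L45–52)] -/
theorem RemC15AsPrinted_holds : RemC15AsPrinted := by
  intro F E _ _ _ _ _ _ _ _ V τ _ hV Φ τ' hτ'
  rw [HermSpace.reducedReflexField, sigFlatElt_eq_single_of_isSignatureN1At V hV Φ,
    fixedField_stabilizer_single_eq]
  -- `τ'` above `τ` is `τ⁻` or its conjugate; both have image `τ⁻(E)`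
  have hres : restr F E τ' = restr F E (CMType.above F E Φ τ) := by
    rw [hτ', (CMType.above_spec F E Φ τ).2]
  rcases eq_or_eq_conjugate_of_restr_eq F E hres with h | h
  · rw [h]
  · rw [h, fieldRange_conjugate F]

/-! ## ED. 2 — discharge of Lemma C.14 (`LemC14AsPrinted_holds`)

[Liu2021, Lem. C.14 (p. 113; FJcycle.tex l. 4789–4795)]: «Let `E♯_{V,Φ}` be the subfield of `ℂ` generated by `E♭_{V,Φ}`
and `E_Φ`. Then `E♯_{V,Φ}` contains `E_{V,Φ}`.»  PRINTED PROOF (l. 4793–4795): an element of `Gal(ℂ/ℚ)` fixing `E♯_{V,Φ}`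
stabilizes `sig♭_{V,Φ}` and `Φ`, hence stabilizes `sig_{V,Φ} = sig♭_{V,Φ} + Σ_τ p_τ τ⁺` — the last identity reads the
coefficient of `τ⁺ ∉ Φ` as `p_τ = n − q_τ`, i.e. uses `p_τ + q_τ = n` (★ `HermSpace.posIndex_add_negIndex`, sibling
`HermSpaceSylvester.lean`, squad TL pen t08).  Formalization, same architecture:
* Step 5 `mem_stabilizer_iff_forall` — `σ ∈ Stab(s)` iff `s(σ ∘ φ) = s(φ)` for every `φ ∈ Φ_E` (`σ ∘ −` permutes the
  finite set `Φ_E`, inverse `σ⁻¹ ∘ −`, ★ `galAct_mul` / `galAct_one`);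
* Step 6 `stabilizer_inf_le_stabilizer_sigElt` — the combinatorial heart, POINTWISE on coefficients (★ `sigElt_apply`,
  ★ `sigFlatElt_apply`): for `φ ∈ Φ` the coefficient is `q_{πφ}` on both sides; for `φ ∉ Φ` it is `p_{πφ}`, and
  `q_{π(σφ)} = q_{πφ}` is read off the conjugate embedding `\bar φ ∈ Φ` (`π(σ ∘ \bar φ) = π(σ ∘ φ)`,
  `restr_galAct_conjugate` — `σ` need not commute with complex conjugation), so `p = n − q` agrees;
* Step 7 `fixingSubgroup_normalClosure_le_stabilizer` / `fixedField_stabilizer_le_normalClosure` — every stabilizer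
  contains `Aut(ℂ/Ẽ)`, `Ẽ ⊆ ℂ` the normal closure of `E` (Mathlib `normalClosure ℚ E ℂ`, finite over `ℚ`), so the
  stabilizers are «closed» (★ `Complex.mem_subgroup_of_fix_fixedField`) and their fixed fields are number fields inside `Ẽ`
  (★ `Complex.mem_of_forall_mem_fixingSubgroup`);
* `LemC14AsPrinted_holds` — for `z ∈ E_{V,Φ} = Fix(Stab sig)`: an automorphism fixing `E♯ = E♭ ⊔ E_Φ` pointwise fixes
  `Fix(Stab sig♭)` and `Fix(Stab Φ)`, hence lies in `Stab sig♭ ∩ Stab Φ ⊆ Stab sig` and fixes `z`; as `E♯ ⊆ Ẽ` is finite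
  over `ℚ`, `Fix(Aut(ℂ/E♯)) = E♯` gives `z ∈ E♯`.
-/

section LemC14

open IntermediateField

omit [NumberField F] [IsTotallyReal F] [NumberField E] [IsTotallyComplex E] [Algebra.IsQuadraticExtension F E] in
/-- **Step 5.** `σ ∈ Gal(ℂ/ℚ)` stabilizes `s ∈ ℕ[Φ_E]` iff `s(σ ∘ φ) = s(φ)` for every `φ ∈ Φ_E` (the action
`σ · φ = σ ∘ φ` permutes `Φ_E`, with inverse `σ⁻¹ · −`). [cite: Liu2021, Def. C.1 (p. 107), «the stabilizer in Gal(ℂ/ℚ)»] -/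
theorem mem_stabilizer_iff_forall (σ : ℂ ≃ₐ[ℚ] ℂ) (s : (E →+* ℂ) →₀ ℕ) :
    σ ∈ stabilizer E s ↔ ∀ φ : E →+* ℂ, s (galAct E σ φ) = s φ := by
  have hinj : Function.Injective (galAct E σ) := by
    intro φ ψ h
    ext x
    exact σ.injective (congrArg (fun f : E →+* ℂ => f x) h)
  have hsurj : Function.Surjective (galAct E σ) := fun φ' =>
    ⟨galAct E σ⁻¹ φ', by
      rw [← Function.comp_apply (f := galAct E σ), ← galAct_mul, mul_inv_cancel, galAct_one]; rfl⟩
  rw [mem_stabilizer_iff, galActElt]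
  constructor
  · intro h φ
    have := Finsupp.mapDomain_apply hinj s φ
    rw [h] at this
    exact this
  · intro h
    ext φ'
    obtain ⟨φ, rfl⟩ := hsurj φ'
    rw [Finsupp.mapDomain_apply hinj, h]

omit [NumberField F] [NumberField E] [IsTotallyComplex E] [Algebra.IsQuadraticExtension F E] in
/-- `π(σ ∘ \bar φ) = π(σ ∘ φ)`: the Galois action preserves the fibres of `π : Φ_E → Φ_F` (both composites agree on `F`,
on which `\bar φ` and `φ` agree — no commutation of `σ` with complex conjugation is needed).
[cite: Liu2021, App. C l. 4550] -/
theorem restr_galAct_conjugate (σ : ℂ ≃ₐ[ℚ] ℂ) (φ : E →+* ℂ) :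
    restr F E (galAct E σ (conjugate φ)) = restr F E (galAct E σ φ) := by
  rw [restr_eq_iff, ← comp_algebraMap_eq_restr F E (galAct E σ φ)]
  ext x
  have h1 : conjugate φ (algebraMap F E x) = φ (algebraMap F E x) := by
    have := congrArg (fun f : F →+* ℂ => f x)
      ((restr_eq_iff F E (conjugate φ) (restr F E φ)).1 (restr_conjugate F E φ))
    simpa [restr_apply_coe] using this
  change σ (conjugate φ (algebraMap F E x)) = σ (φ (algebraMap F E x))
  rw [h1]

/-- **Step 6 (the combinatorial heart of the printed proof).** `Stab(sig♭_{V,Φ}) ∩ Stab(Φ) ⊆ Stab(sig_{V,Φ})`: an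
automorphism stabilizing `sig♭_{V,Φ} = Σ_τ q_τ τ⁻` and the type `Φ` (as `Σ_{φ∈Φ} φ ∈ ℕ[Φ_E]`, ★ `cmTypeElt`) stabilizes
`sig_{V,Φ} = sig♭_{V,Φ} + Σ_τ p_τ τ⁺`, because `p_τ = n − q_τ` (★ `HermSpace.posIndex_add_negIndex`).
[cite: Liu2021, Lem. C.14 proof (p. 113; FJcycle.tex l. 4793–4795)] -/
theorem stabilizer_inf_le_stabilizer_sigElt (V : HermSpace F E) (Φ : CMType E) :
    stabilizer E (V.sigFlatElt Φ) ⊓ stabilizer E (cmTypeElt E Φ) ≤ stabilizer E (V.sigElt Φ) := by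
  classical
  intro σ hσ
  rw [Subgroup.mem_inf, mem_stabilizer_iff_forall, mem_stabilizer_iff_forall] at hσ
  obtain ⟨hflat, hΦ⟩ := hσ
  -- `σ` preserves membership in `Φ`
  have hmem : ∀ φ : E →+* ℂ, galAct E σ φ ∈ Φ.1 ↔ φ ∈ Φ.1 := by
    intro φ
    have h := hΦ φ
    simp only [cmTypeElt, Finsupp.ofSupportFinite_coe, Set.indicator_apply] at h
    by_cases h1 : galAct E σ φ ∈ Φ.1 <;> by_cases h2 : φ ∈ Φ.1 <;> simp_all
  -- `q` is preserved along `σ` on `Φ`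
  have hq : ∀ φ : E →+* ℂ, φ ∈ Φ.1 → V.negIndex (restr F E (galAct E σ φ)) = V.negIndex (restr F E φ) := by
    intro φ hφ
    have h := hflat φ
    rw [V.sigFlatElt_apply, V.sigFlatElt_apply, if_pos hφ, if_pos ((hmem φ).2 hφ)] at h
    exact h
  rw [mem_stabilizer_iff_forall]
  intro φ
  rw [V.sigElt_apply, V.sigElt_apply]
  by_cases hφ : φ ∈ Φ.1
  · rw [if_pos hφ, if_pos ((hmem φ).2 hφ)]
    exact hq φ hφ
  · have hφ' : galAct E σ φ ∉ Φ.1 := fun h => hφ ((hmem φ).1 h)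
    rw [if_neg hφ, if_neg hφ']
    -- read `q` off the conjugate embedding `\bar φ ∈ Φ` (a CM type contains exactly one of `φ`, `\bar φ`), then `p = n − q`
    have hc : conjugate φ ∈ Φ.1 := by
      by_contra hc
      exact hφ ((Φ.2 φ).2 hc)
    have h1 := hq (conjugate φ) hc
    rw [restr_galAct_conjugate, restr_conjugate] at h1
    have h2 := V.posIndex_add_negIndex (restr F E (galAct E σ φ))
    have h3 := V.posIndex_add_negIndex (restr F E φ)
    change V.posIndex (restr F E (galAct E σ φ)) = V.posIndex (restr F E φ)
    omega

omit [NumberField F] [IsTotallyReal F] [IsTotallyComplex E] [Algebra.IsQuadraticExtension F E] in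
/-- **Step 7.** Every stabilizer contains `Aut(ℂ/Ẽ)`, `Ẽ = normalClosure ℚ E ℂ` the normal closure of `E` in `ℂ` (the
compositum of the `φ(E)`, `φ ∈ Φ_E`): an automorphism fixing every `φ(E)` pointwise fixes every `φ`.
[cite: Liu2021, App. C l. 4550, «Gal(ℂ/ℚ) acts on Φ_E»] -/
theorem fixingSubgroup_normalClosure_le_stabilizer (s : (E →+* ℂ) →₀ ℕ) :
    (normalClosure ℚ E ℂ).fixingSubgroup ≤ stabilizer E s := by
  intro τ hτ
  rw [mem_stabilizer_iff_forall]
  intro φ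
  have hφ : galAct E τ φ = φ := by
    ext x
    change τ (φ x) = φ x
    have hx : φ x ∈ normalClosure ℚ E ℂ := (φ.toRatAlgHom).fieldRange_le_normalClosure ⟨x, rfl⟩
    exact (mem_fixingSubgroup_iff _ _).mp hτ _ hx
  rw [hφ]

omit [NumberField F] [IsTotallyReal F] [IsTotallyComplex E] [Algebra.IsQuadraticExtension F E] in
/-- **Step 7′.** The fixed field of a stabilizer lies in the number field `Ẽ = normalClosure ℚ E ℂ`
(`Fix(Stab s) ⊆ Fix(Aut(ℂ/Ẽ)) = Ẽ`, ★ `Complex.mem_of_forall_mem_fixingSubgroup`); in particular `E_{V,Φ}`, `E♭_{V,Φ}`,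
`E_Φ`, `E♯_{V,Φ}` are number fields. [cite: Lang2002, Ch. VI §1, Thm. 1.8 (via ★ AutComplexFiniteIndex)] -/
theorem fixedField_stabilizer_le_normalClosure (s : (E →+* ℂ) →₀ ℕ) :
    fixedField (stabilizer E s) ≤ normalClosure ℚ E ℂ := by
  intro z hz
  refine Complex.mem_of_forall_mem_fixingSubgroup (normalClosure ℚ E ℂ) fun τ hτ => ?_
  exact (mem_fixedField_iff _ z).mp hz τ (fixingSubgroup_normalClosure_le_stabilizer s hτ)

omit [NumberField F] [IsTotallyReal F] [IsTotallyComplex E] [Algebra.IsQuadraticExtension F E] in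
/-- **Step 7″ (closedness).** An automorphism of `ℂ` fixing `Fix(Stab s)` pointwise lies in `Stab s` (the subgroup
`Stab s ⊇ Aut(ℂ/Ẽ)` has finite level: ★ `Complex.mem_subgroup_of_fix_fixedField`).
[cite: Lang2002, Ch. VI §1, Thm. 1.8 (via ★ AutComplexClosedSubgroups)] -/
theorem mem_stabilizer_of_fix_fixedField (s : (E →+* ℂ) →₀ ℕ) {σ : ℂ ≃ₐ[ℚ] ℂ}
    (hσ : ∀ z ∈ fixedField (stabilizer E s), σ z = z) : σ ∈ stabilizer E s := by
  haveI : FiniteDimensional ℚ (normalClosure ℚ E ℂ) := inferInstance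
  exact Complex.mem_subgroup_of_fix_fixedField (stabilizer E s) (normalClosure ℚ E ℂ).toSubfield
    (fun τ hτ => fixingSubgroup_normalClosure_le_stabilizer s
      ((mem_fixingSubgroup_iff _ _).mpr fun x hx => hτ x hx)) hσ

/-- **[Liu2021, Lemma C.14] HOLDS** — discharge of the CLOSED named fact ★ `LemC14AsPrinted` of the carpet
★ `SecC3Connection.lean` (statement byte-unchanged there): for every CM extension `E/F`, hermitian space `V` over `E` and
CM type `Φ`, `E_{V,Φ} ⊆ E♯_{V,Φ}` (the subfield of `ℂ` generated by `E♭_{V,Φ}` and `E_Φ`).  Assembly of Steps 5–7 with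
the printed argument: `z ∈ E_{V,Φ} = Fix(Stab sig_{V,Φ})`; any `σ ∈ Aut(ℂ/E♯_{V,Φ})` fixes `E♭_{V,Φ} = Fix(Stab sig♭)` and
`E_Φ = Fix(Stab Φ)` pointwise, so `σ ∈ Stab sig♭ ∩ Stab Φ ⊆ Stab sig_{V,Φ}` (Step 6, using `p_τ + q_τ = n`) and `σ z = z`;
since `E♯_{V,Φ} ⊆ Ẽ` is finite over `ℚ`, `z ∈ Fix(Aut(ℂ/E♯_{V,Φ})) = E♯_{V,Φ}`.
[cite: Liu2021, Lem. C.14 (p. 113; FJcycle.tex l. 4789–4795)] -/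
theorem LemC14AsPrinted_holds : LemC14AsPrinted := by
  intro F E _ _ _ _ _ _ _ _ V Φ z hz
  -- `E♯ = E♭ ⊔ E_Φ ≤ Ẽ` is finite over `ℚ`
  have hle : sharpReflexField F E V Φ ≤ normalClosure ℚ E ℂ :=
    sup_le (fixedField_stabilizer_le_normalClosure (V.sigFlatElt Φ))
      (fixedField_stabilizer_le_normalClosure (cmTypeElt E Φ))
  haveI : FiniteDimensional ℚ (sharpReflexField F E V Φ) :=
    FiniteDimensional.of_injective (IntermediateField.inclusion hle).toLinearMap
      (IntermediateField.inclusion_injective hle)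
  refine Complex.mem_of_forall_mem_fixingSubgroup (sharpReflexField F E V Φ) fun σ hσ => ?_
  have hσ' := (mem_fixingSubgroup_iff _ _).mp hσ
  -- `σ` fixes `E♭` and `E_Φ` pointwise, hence stabilizes `sig♭` and `Φ` (closedness), hence `sig` (Step 6)
  have h1 : σ ∈ stabilizer E (V.sigFlatElt Φ) :=
    mem_stabilizer_of_fix_fixedField _ fun w hw =>
      hσ' w (le_sup_left (a := V.reducedReflexField Φ) (b := cmReflexField E Φ) hw)
  have h2 : σ ∈ stabilizer E (cmTypeElt E Φ) :=
    mem_stabilizer_of_fix_fixedField _ fun w hw =>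
      hσ' w (le_sup_right (a := V.reducedReflexField Φ) (b := cmReflexField E Φ) hw)
  have h3 : σ ∈ stabilizer E (V.sigElt Φ) :=
    stabilizer_inf_le_stabilizer_sigElt V Φ (Subgroup.mem_inf.mpr ⟨h1, h2⟩)
  exact (V.mem_reflexField_iff Φ z).mp hz σ h3

end LemC14

end Literature.NumberTheory.Automorphic.Liu2021.AppendixC.SecC3Connection

end
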